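import Summits.CriticalPhenomena.PercolationContinuityZ3.Theorems.PercNearOneGluingNoHeavyLowerTailSahiCombMixAnd
import Summits.CriticalPhenomena.PercolationContinuityZ3.Theorems.PercNearOneGluingNoHeavyLowerTailSahiCombMixFourMain
import Summits.CriticalPhenomena.PercolationContinuityZ3.Theorems.PercNearOneGluingNoHeavyLowerTailSahiCombReadOnce

/-!
# The comb (tensor-Bernstein) hierarchy for Sahi's `E_k`, XLVI: NESTED CANALYZING ("caterpillar") FAMILIES — alternating OR- and AND-steps;
# every family of four read-once decision-list events along a common coordinate order is comb-positive at every order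

Support file of the one-cut programme (crux `NoHeavyLowerTail`, stmt-CriticalPhenomena-4575; cell `prim-masterthm`, seat P3, gen 9;
`run/shared/lean/prim/prim-masterthm/prim-masterthm-p3/HIERARCHY.md` §17).  Combines COMB H-MIX(4) (`SahiCombMix.combHereditary_orCoord_four`, gen 8: the OR step
for four events) with the COMB MEET STEP (`SahiCombHereditary.combHereditary_andCoord`, every `n`, `…SahiCombMixAnd`) and the read-once transfer
(`CombPos.readOnce`, `…SahiCombReadOnce`).

THE CLASS.  Fix `n` members and a start pattern `c : Fin n → Bool` (member `j` starts as `Ω` if `c j`, else `∅`).  A STEP `⟨op, e, G⟩` replaces `U_j` by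
`U_j ∪ {e ∈ ω}` (`op = true`) or `U_j ∩ {e ∈ ω}` (`op = false`) for the selected members `G j = true`.  A list of steps with pairwise distinct coordinates, applied
innermost-first, builds the CATERPILLAR FAMILY `caterpillar c L`: member `j` is the read-once DECISION LIST (nested canalyzing function with positive literals) "scan the
steps from the last to the first; at an OR step selecting `j` accept if `e ∈ ω`, at an AND step selecting `j` reject if `e ∉ ω`; at the end answer `c j`", all members
reading the coordinates in the SAME order.  Examples (four members): every hitting family `({ω ∩ S_j ≠ ∅})_j` (OR steps only), every cylinder family (AND steps only),
ladders such as `( (a ∪ b) ∩ c ∪ d,  (b ∩ c) ∪ d,  a ∪ b ∪ e,  ((a ∩ c) ∪ d) ∩ e )`.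
* `caterpillar`, `isUpperSet_caterpillar`, `determinedBy_caterpillar` (bookkeeping).
* **`combHereditary_caterpillar_four`** — for FOUR members and any step list with distinct coordinates, the caterpillar family is `CombHereditary`: every row
  `E_m(μ_p; ⋂_{K_1} U, …, ⋂_{K_m} U)` of its ∩-closed family has nonnegative tensor-Bernstein coefficients (induction on the steps: constant families are chains; OR step =
  comb H-MIX(4); AND step = comb meet step).  `combHereditary_caterpillar_three` likewise (comb H-MIX(3)).
* `sahiE_caterpillar_four_nonneg` — law-level shadow: under every product measure every such row, in particular `E_4(μ_p; U_0, U_1, U_2, U_3)`, is `≥ 0`.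
* **`CombHereditary.readOnce`** — the hereditary comb class is closed under read-once substitution of independent increasing gadgets (from `CombPos.readOnce`); hence
  (`combHereditary_caterpillar_four_readOnce`) the leaves `{e ∈ ω}` of a four-member caterpillar may be replaced by ARBITRARY increasing events on pairwise disjoint
  coordinate blocks.
PLACE IN THE HIERARCHY: extends gen 8's hitting families of four sets (OR-only lists) to mixed OR/AND lists; sharp use of n = 4 (the OR step fails from five events on,
`…SahiMixtureHereditaryCex5`), while the AND step is valid for every `n`.  HONEST FRAMING: Sahi's (M⁺-4) / `C_4` for general increasing events remain OPEN. [this work]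
-/

noncomputable section

open scoped Classical

namespace Summit.CriticalPhenomena.PercolationContinuityZ3.Theorems

open Finset Function
open Literature.Combinatorics.Sahi2008
open Literature.Probability.Percolation (DeterminedBy determinedBy_iff determinedBy_univ)
open Literature.Probability.Percolation.DecisionTree (ind ind_of_mem ind_of_not_mem ind_nonneg)
open SahiComb
open SahiCombDisjunct (orCoord CombAllOrders)

variable {ι : Type} [Fintype ι]

namespace SahiCombHereditary

/-! ### Steps and caterpillar families -/

/-- One construction step: OR (`op = true`) or AND (`op = false`) the coordinate event `{coord ∈ ω}` into the members selected by `sel`. [this work] -/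
structure MixStep (ι : Type) (n : ℕ) where
  /-- `true` = OR step (`SahiCombDisjunct.orCoord`), `false` = AND step (`andCoord`) -/
  op : Bool
  /-- the coordinate read at this step -/
  coord : ι
  /-- the members the step acts on -/
  sel : Fin n → Bool

/-- Apply one step to a family. [this work] -/
def mixStep {n : ℕ} (U : Fin n → Set (Set ι)) (s : MixStep ι n) : Fin n → Set (Set ι) :=
  bif s.op then orCoord U s.coord s.sel else andCoord U s.coord s.sel

/-- **The caterpillar family** of a start pattern `c` (member `j` starts as `Ω` if `c j`, else `∅`) and a step list (head = outermost = last step). [this work] -/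
def caterpillar {n : ℕ} (c : Fin n → Bool) : List (MixStep ι n) → Fin n → Set (Set ι)
  | [] => fun j => bif c j then Set.univ else ∅
  | s :: L => mixStep (caterpillar c L) s

/-- The coordinates read by a step list. [this work] -/
def stepCoords {n : ℕ} (L : List (MixStep ι n)) : Set ι := {x | x ∈ L.map MixStep.coord}

omit [Fintype ι] in
/-- Caterpillar members are increasing events. [this work] -/
theorem isUpperSet_caterpillar {n : ℕ} (c : Fin n → Bool) : ∀ (L : List (MixStep ι n)) (j : Fin n), IsUpperSet (caterpillar c L j)
  | [], j => by
    unfold caterpillar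
    cases c j
    · exact isUpperSet_empty
    · exact isUpperSet_univ
  | s :: L, j => by
    unfold caterpillar mixStep
    cases s.op
    · exact isUpperSet_andCoord (isUpperSet_caterpillar c L) s.coord s.sel j
    · exact SahiCombDisjunct.isUpperSet_orCoord (isUpperSet_caterpillar c L) s.coord s.sel j

omit [Fintype ι] in
/-- OR-ing or AND-ing `{e ∈ ω}` into an event determined by a coordinate set containing `e` keeps it so determined. [folklore] -/
theorem determinedBy_mix_coord {V : Set (Set ι)} {S : Set ι} {e : ι} (hV : DeterminedBy V S) (he : e ∈ S) (op b : Bool) :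
    DeterminedBy (bif op then (bif b then V ∪ {ω : Set ι | e ∈ ω} else V) else (bif b then V ∩ {ω : Set ι | e ∈ ω} else V)) S := by
  have hE : DeterminedBy {ω : Set ι | e ∈ ω} S := by
    rw [determinedBy_iff]
    intro ω ω' h
    have := Set.ext_iff.1 h e
    simp only [Set.mem_inter_iff, he, and_true] at this
    exact this
  have hU : DeterminedBy (V ∪ {ω : Set ι | e ∈ ω}) S := by
    rw [determinedBy_iff] at hV hE ⊢
    intro ω ω' h
    simp only [Set.mem_union]
    rw [hV ω ω' h, hE ω ω' h]
  cases op <;> cases b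
  · exact hV
  · exact hV.inter hE
  · exact hV
  · exact hU

omit [Fintype ι] in
/-- Caterpillar members are determined by the coordinates read. [this work] -/
theorem determinedBy_caterpillar {n : ℕ} (c : Fin n → Bool) :
    ∀ (L : List (MixStep ι n)) (j : Fin n), DeterminedBy (caterpillar c L j) (stepCoords L)
  | [], j => by
    unfold caterpillar
    cases c j
    · rw [determinedBy_iff]; intro ω ω' _; simp
    · exact determinedBy_univ _
  | ⟨op, e, G⟩ :: L, j => by
    have ih : DeterminedBy (caterpillar c L j) (stepCoords (⟨op, e, G⟩ :: L)) :=
      (determinedBy_caterpillar c L j).mono fun x hx => by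
        simp only [stepCoords, List.map_cons, List.mem_cons, Set.mem_setOf_eq] at hx ⊢
        exact Or.inr hx
    have hs : e ∈ stepCoords (⟨op, e, G⟩ :: L) := by simp [stepCoords]
    have h := determinedBy_mix_coord ih hs op (G j)
    cases op <;> simpa [caterpillar, mixStep, SahiCombDisjunct.orCoord, andCoord] using h

omit [Fintype ι] in
/-- A caterpillar family ignores every coordinate not read by its steps. [this work] -/
theorem secAt_caterpillar_of_notMem {n : ℕ} (c : Fin n → Bool) (L : List (MixStep ι n)) {e : ι} (he : e ∉ L.map MixStep.coord)
    (j : Fin n) (b : Bool) : secAt e b (caterpillar c L j) = caterpillar c L j :=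
  SahiCombJunta.secAt_eq_self_of_determinedBy (determinedBy_caterpillar c L j) he b

/-! ### Four (and three) members: comb-positive at every order -/

/-- **CATERPILLAR FAMILIES OF FOUR EVENTS ARE HEREDITARILY COMB-POSITIVE.**  For every start pattern and every step list reading pairwise distinct coordinates, the
∩-closed family of the four caterpillar events is comb-positive at every order.  Induction on the steps: constant families are chains (`combHereditary_constFamily`);
an OR step is comb H-MIX(4) (`SahiCombMix.combHereditary_orCoord_four`); an AND step is the comb meet step (`combHereditary_andCoord`). [this work] -/
theorem combHereditary_caterpillar_four (c : Fin 4 → Bool) :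
    ∀ (L : List (MixStep ι 4)), (L.map MixStep.coord).Nodup → CombHereditary (caterpillar c L)
  | [], _ => combHereditary_constFamily c
  | s :: L, hL => by
    rw [List.map_cons, List.nodup_cons] at hL
    have ih := combHereditary_caterpillar_four c L hL.2
    have hup := isUpperSet_caterpillar c L
    have hig := secAt_caterpillar_of_notMem c L hL.1
    show CombHereditary (mixStep (caterpillar c L) s)
    unfold mixStep
    cases s.op
    · exact combHereditary_andCoord _ s.coord s.sel hig ih
    · exact SahiCombMix.combHereditary_orCoord_four _ s.coord s.sel hup hig ih

/-- The same for THREE members (comb H-MIX(3), `combHereditaryMixture_three`). [this work] -/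
theorem combHereditary_caterpillar_three (c : Fin 3 → Bool) :
    ∀ (L : List (MixStep ι 3)), (L.map MixStep.coord).Nodup → CombHereditary (caterpillar c L)
  | [], _ => combHereditary_constFamily c
  | s :: L, hL => by
    rw [List.map_cons, List.nodup_cons] at hL
    have ih := combHereditary_caterpillar_three c L hL.2
    have hup := isUpperSet_caterpillar c L
    have hig := secAt_caterpillar_of_notMem c L hL.1
    show CombHereditary (mixStep (caterpillar c L) s)
    unfold mixStep
    cases s.op
    · exact combHereditary_andCoord _ s.coord s.sel hig ih
    · exact combHereditaryMixture_three _ s.coord s.sel hup hig ih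

/-- AND-only step lists give `CombHereditary` families for EVERY number of members (cylinder-type families; recorded for completeness). [this work] -/
theorem combHereditary_caterpillar_and {n : ℕ} (c : Fin n → Bool) :
    ∀ (L : List (MixStep ι n)), (L.map MixStep.coord).Nodup → (∀ s ∈ L, s.op = false) → CombHereditary (caterpillar c L)
  | [], _, _ => combHereditary_constFamily c
  | s :: L, hL, hops => by
    rw [List.map_cons, List.nodup_cons] at hL
    have ih := combHereditary_caterpillar_and c L hL.2 fun t ht => hops t (List.mem_cons_of_mem s ht)
    have hig := secAt_caterpillar_of_notMem c L hL.1
    have hs : s.op = false := hops s List.mem_cons_self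
    show CombHereditary (mixStep (caterpillar c L) s)
    unfold mixStep
    rw [hs]
    exact combHereditary_andCoord _ s.coord s.sel hig ih

/-- **Law-level shadow.**  Under every product measure, every row of the ∩-closed family of a four-member caterpillar family is nonnegative. [this work] -/
theorem sahiE_caterpillar_four_nonneg (c : Fin 4 → Bool) (L : List (MixStep ι 4)) (hL : (L.map MixStep.coord).Nodup)
    (p : ι → unitInterval) (m : ℕ) (K : Fin m → Finset (Fin 4)) :
    0 ≤ sahiE (bernoulliWeight p) m (fun j => ind (⋂ i ∈ K j, caterpillar c L i)) :=
  ((combHereditary_caterpillar_four c L hL).hereditaryAllOrders p) m K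

/-- In particular `E_4(μ_p; U_0, U_1, U_2, U_3) ≥ 0` for the four caterpillar events themselves. [this work] -/
theorem sahiE_four_caterpillar_nonneg (c : Fin 4 → Bool) (L : List (MixStep ι 4)) (hL : (L.map MixStep.coord).Nodup) (p : ι → unitInterval) :
    0 ≤ sahiE (bernoulliWeight p) 4 (fun j => ind (caterpillar c L j)) := by
  have h := sahiE_caterpillar_four_nonneg c L hL p 4 (fun j => {j})
  refine le_of_le_of_eq h ?_
  congr 1; funext j
  rw [Finset.set_biInter_singleton]

/-! ### Read-once substitution of independent increasing gadgets -/

section ReadOnce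

variable {κ : Type} [Fintype κ]

omit [Fintype ι] [Fintype κ] in
/-- Read-once substitution commutes with intersections of members. [folklore] -/
theorem readOnce_biInter {n : ℕ} (G : κ → Set (Set ι)) (U : Fin n → Set (Set κ)) (K : Finset (Fin n)) :
    {ω : Set ι | {e | ω ∈ G e} ∈ ⋂ i ∈ K, U i} = ⋂ i ∈ K, {ω : Set ι | {e | ω ∈ G e} ∈ U i} := by
  ext ω; simp

/-- **The hereditary comb class is closed under read-once substitution of independent gadgets**: for `π : ι → κ` and gadgets `G e` determined by the fibre of `e`,
`CombHereditary U → CombHereditary (U_j ∘ G)_j`. [this work] -/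
theorem CombHereditary.readOnce (π : ι → κ) (G : κ → Set (Set ι)) (hG : ∀ e, DeterminedBy (G e) {i | π i = e}) {n : ℕ}
    {U : Fin n → Set (Set κ)} (hU : CombHereditary U) :
    CombHereditary (fun j => {ω : Set ι | {e | ω ∈ G e} ∈ U j}) := by
  intro m K
  have h := SahiCombReadOnce.CombPos.readOnce π G hG (hU m K)
  refine h.congr fun q => ?_
  congr 1; funext j
  rw [readOnce_biInter]

/-- Hence: a four-member caterpillar family on a base cube `κ`, with every leaf `{e ∈ ω}` replaced by an increasing gadget `G e ⊆ 2^ι` on its own block of coordinates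
(blocks = fibres of `π`), is `CombHereditary` on `2^ι`. [this work] -/
theorem combHereditary_caterpillar_four_readOnce (π : ι → κ) (G : κ → Set (Set ι)) (hG : ∀ e, DeterminedBy (G e) {i | π i = e})
    (c : Fin 4 → Bool) (L : List (MixStep κ 4)) (hL : (L.map MixStep.coord).Nodup) :
    CombHereditary (fun j => {ω : Set ι | {e | ω ∈ G e} ∈ caterpillar c L j}) :=
  (combHereditary_caterpillar_four c L hL).readOnce π G hG

end ReadOnce

end SahiCombHereditary

end Summit.CriticalPhenomena.PercolationContinuityZ3.Theorems

end
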